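import Summits.AnomalousDissipation.AnomalousDissipation.Theses.NeutralTaylorWaves

/-!
# Crux `TaylorWaveQuasiSteady` (stmt-AnomalousDissipation-16293, route NeutralTaylorWaves, rank 3) — birth skeleton (BC3)

`Lines/birth.lean` of the CONSTRUCTION crux of route `NeutralTaylorWaves`: ONE fixed smooth divergence-free
mean-zero force `f`, `ν_n → 0⁺`, `E`, `ε₀ > 0` and, for every order `K`, a constant `C_K` and for EVERY `n` smooth
divergence-free mean-zero `w`, smooth `q`, drift `|c| ≤ C_K` with `∫|w|² ≤ E` (light), `|ν_n‖∇w‖² − ε₀| ≤ C_K√ν_n`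
(loud), `‖w·∇w − ν_nΔw + ∇q − c∂₂w − f‖₂² ≤ C_K ν_n^K` (quasi-steady to all orders with the SAME `f`).

## The cut: FORMAL (profile level, `T³ × T¹`) → RIGOROUS (evaluation on the fast phase)

The crux is a nonlinear-geometric-optics (BKW) construction.  Every such construction factors through the same
seam, and the seam is typed here with the tree's torus calculus (`UnitAddTorus (Fin 4)` carries the profile
variables `(x, θ)`; no new Literature notion is needed):

* `stub_profiles` (HARDEST, open — the crux transferred to `C⁺`): an all-orders family of smooth monophase
  profiles `P_{K,n}(x, θ)`, `Q_{K,n}`, drifts `c_{K,n}` and ONE force `f` solving the two-scale steady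
  Navier–Stokes system on `T⁴` to order `ν_n^K` POINTWISE, exactly two-scale divergence-free, light, slow-`C¹`
  bounded uniformly in `n`, horizontally mean-free after evaluation, and LOUD on the fast phase
  (`∫_{T⁴}|k|²‖∂_θP‖² → ε₀ > 0` at rate `ε_n`).  `C⁺` is easier than the crux in the precise sense that `ε`
  is a COEFFICIENT of PDEs on a fixed domain: formal power series in `ε`, a triangular hierarchy of LINEAR
  profile equations after the leading (neutral Kelvin wave) order, solvability = streamline-circulation
  conditions — the route's declared mechanism (Cheverry–Guès–Métivier doi:10.1016/j.ansens.2003.10.001,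
  Cheverry arXiv:math/0402408, Lifschitz–Hameiri doi:10.1063/1.858155, Bayly doi:10.1103/physrevlett.57.2160).
* `stub_taylorDissipationLaw` (true, M): `ν_n‖∇(P∘e_n)‖₂² = ∫_{T⁴}|k|²‖∂_θP‖² + O(ε_n)` — two-scale chain rule
  plus the fast-phase AVERAGING LEMMA with rate `1/((n+1)m)`; this is where LOUD with rate `√ν` comes from.
* `stub_residualTransfer` (true, M): the evaluated, vertically Galilei-normalised field `w = P∘e_n − a e₂`,
  `c' = c − a` is smooth, divergence free, mean zero, light, has the same enstrophy, and its steady residual is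
  the evaluated profile residual pointwise (first- and second-order two-scale chain rule through the smooth
  phase map `e_n : T³ → T⁴`), hence `≤ C ν_n^K` in `L²`.
* `TaylorWaveQuasiSteady_of` (REAL proof, no `sorry`): `ν_n := ε_n² = 1/(n+1)²` (positive, `→ 0`,
  `√ν_n = ε_n`), the force and levels of stub 1, constants `max C₂ (C₁ + C_K)`, triangle inequality for LOUD.

Normalisations (no loss): `ν_n = ε_n²` exactly (a factor `κ` is removed by the amplitude scaling
`(w, q, c, f, ν) ↦ (aw, a²q, ac, a²f, aν)` of steady Navier–Stokes); the fast phase has unit period; the drift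
axis `e₂` is the crux's `∂₂`; only HORIZONTAL means are constrained (the vertical mean is absorbed EXACTLY by the
drift: `(W − ae₂)·∇(W − ae₂) − (c − a)∂₂(W − ae₂) = W·∇W − c∂₂W`).

Costume check: the `θ`-independent embedding `P(x, θ) := w_n(x)` of an arbitrary crux family into stub 1 FAILS
(`∂_θP = 0` forces `∫|k|²‖∂_θP‖² = 0 ≠ ε₀`, and `‖∂ᵢP‖ ≤ C_K` uniformly in `n` fails for gradients `∼ ν^{-1/2}`):
stub 1 is strictly more structured than the crux (the loud family IS a monophase two-scale family), not a
restatement; stubs 2–3 cannot produce a force or a loud family on their own (BC3 probes, NOTES.md).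

Disproof used: none relevant — `ledger crux ls stmt-AnomalousDissipation-16293` shows no `Disproof.lean` /
`Negative/` lemma (2026-08-17); the negatives index of the summit (6 refuted statements: ScalarLift2halfD,
CorrelationEnergyUnboundedNeg, TaylorCertificatePair, GPEnergyCeiling, EnsembleCeilingBridge, RobustDecayQuantum)
contains nothing about two-scale quasi-steady families, so no stub instantiates a refuted statement.
Hardest stub: `stub_profiles` (its why-might-fail is the crux's own).  Registrar seat
`planner-skel-stmt-AnomalousDissipation-16293-0`, 2026-08-17; single-source generator `gen_birth.py` in the seat folder.
-/

-- `Summit.<Summit>.<Problem>`: single-conjunct summit, the duplicate namespace component is mandated (CONVENTIONS §2).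
set_option linter.dupNamespace false

noncomputable section

open scoped BigOperators InnerProductSpace
open Filter Set Topology MeasureTheory

namespace Summit.AnomalousDissipation.AnomalousDissipation.Cruxes.TaylorWaveQuasiSteady.Birth

/-! ## Local two-scale (monophase BKW) vocabulary on `T⁴ = T³ × T¹`

A PROFILE is a function on `UnitAddTorus (Fin 4)`: slow point `x = (y₀, y₁, y₂) ∈ T³`, fast phase
`θ = y₃ ∈ T¹ = ℝ/ℤ`.  The phase of the line is `S(x) = m·x₂ + G(x₀, x₁)` (`m ∈ ℕ`, `m ≥ 1`, the axial
wavenumber; `G` smooth and `x₂`-independent — in the route `G = G̃ ∘ ψ`, a first integral of the base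
array), the small parameter is `ε_n = 1/(n+1)` (wavelength = Taylor microscale), the viscosity is
`ν_n = ε_n²`, and the evaluated field at level `n` is `w(x) = P(x, θ_n(x))` with the fast phase
`θ_n(x) = S(x)/ε_n = (n+1)m·x₂ + (n+1)G(x) (mod 1)` — well defined on `T³` because `(n+1)m ∈ ℕ`.
Chain rule: `∂ᵢ[P ∘ e_n] = (∂ᵢP + ε⁻¹ kᵢ ∂_θ P) ∘ e_n` with `k = ∇S = ∇G + m e₂`, whence the
two-scale operators below (all stated with the tree's `Torus.partialDeriv` on `T⁴`; the bridges
`Torus.fderiv_apply_eq_sum_partialDeriv`, `Torus.laplacian_eq_sum_partialDeriv_partialDeriv`,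
`Torus.gradient_apply` identify them with `Torus.convect/laplacian/gradient` of the evaluated field). -/

/-- `ε_n = 1/(n+1)`: the small parameter (wavelength, = Taylor microscale `√ν_n`) at level `n`. -/
def epsN (n : ℕ) : ℝ := 1 / ((n : ℝ) + 1)

/-- `ν_n = ε_n²`: the viscosity at level `n` (so that `ν_n Δ` is `O(1)` on the fast phase). -/
def nuN (n : ℕ) : ℝ := epsN n ^ 2

/-- The slow point of a two-scale point `y = (x, θ) ∈ T⁴`: forget the fast phase. -/
def slow (y : UnitAddTorus (Fin 4)) : UnitAddTorus (Fin 3) := fun i => y i.castSucc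

/-- The fast phase at level `n`: `θ_n(x) = (n+1)m • x₂ + ↑((n+1) G x) ∈ ℝ/ℤ` (`= S(x)/ε_n mod 1`). -/
def fastPhase (m : ℕ) (G : UnitAddTorus (Fin 3) → ℝ) (n : ℕ) (x : UnitAddTorus (Fin 3)) : UnitAddCircle :=
  ((n + 1) * m) • x 2 + ((((n : ℝ) + 1) * G x : ℝ) : UnitAddCircle)

/-- The two-scale evaluation map `e_n : T³ → T⁴`, `x ↦ (x, θ_n x)`. -/
def phaseMap (m : ℕ) (G : UnitAddTorus (Fin 3) → ℝ) (n : ℕ) (x : UnitAddTorus (Fin 3)) : UnitAddTorus (Fin 4) :=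
  @Fin.snoc 3 (fun _ => UnitAddCircle) x (fastPhase m G n x)

/-- Components of the phase gradient `k = ∇S = ∇G + m e₂` (with `∂₂G = 0`: `k = (∂₀G, ∂₁G, m)`). -/
def phaseGrad (m : ℕ) (G : UnitAddTorus (Fin 3) → ℝ) (i : Fin 3) (x : UnitAddTorus (Fin 3)) : ℝ :=
  Literature.Analysis.FunctionSpaces.Torus.partialDeriv i G x + if i = 2 then (m : ℝ) else 0

/-- The two-scale partial derivative in the slow direction `i` at scale `ε`:
`D^ε_i Φ = ∂_{yᵢ} Φ + ε⁻¹ kᵢ(x) ∂_θ Φ` (`θ` = the last coordinate of `T⁴`). -/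
def tsDeriv {F : Type*} [NormedAddCommGroup F] [NormedSpace ℝ F] (ε : ℝ) (m : ℕ)
    (G : UnitAddTorus (Fin 3) → ℝ) (i : Fin 3) (Φ : UnitAddTorus (Fin 4) → F) (y : UnitAddTorus (Fin 4)) : F :=
  Literature.Analysis.FunctionSpaces.Torus.partialDeriv i.castSucc Φ y +
    (ε⁻¹ * phaseGrad m G i (slow y)) • Literature.Analysis.FunctionSpaces.Torus.partialDeriv (Fin.last 3) Φ y

/-- Two-scale divergence `∑ᵢ D^ε_i Pᵢ`. -/
def tsDiv (ε : ℝ) (m : ℕ) (G : UnitAddTorus (Fin 3) → ℝ) (P : UnitAddTorus (Fin 4) → EuclideanSpace ℝ (Fin 3))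
    (y : UnitAddTorus (Fin 4)) : ℝ :=
  ∑ i : Fin 3, (tsDeriv ε m G i P y) i

/-- Two-scale convective derivative `(P · D^ε) Φ = ∑ⱼ Pⱼ D^ε_j Φ`. -/
def tsConvect {F : Type*} [NormedAddCommGroup F] [NormedSpace ℝ F] (ε : ℝ) (m : ℕ)
    (G : UnitAddTorus (Fin 3) → ℝ) (P : UnitAddTorus (Fin 4) → EuclideanSpace ℝ (Fin 3))
    (Φ : UnitAddTorus (Fin 4) → F) (y : UnitAddTorus (Fin 4)) : F :=
  ∑ j : Fin 3, (P y) j • tsDeriv ε m G j Φ y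

/-- Two-scale Laplacian `∑ᵢ D^ε_i D^ε_i Φ` (`= |k|² ε⁻² ∂_θ² + 2ε⁻¹ k·∇∂_θ + ε⁻¹ (ΔS) ∂_θ + Δ_x`). -/
def tsLaplacian {F : Type*} [NormedAddCommGroup F] [NormedSpace ℝ F] (ε : ℝ) (m : ℕ)
    (G : UnitAddTorus (Fin 3) → ℝ) (Φ : UnitAddTorus (Fin 4) → F) (y : UnitAddTorus (Fin 4)) : F :=
  ∑ i : Fin 3, tsDeriv ε m G i (tsDeriv ε m G i Φ) y

/-- Two-scale gradient of a scalar profile, `(D^ε_i Q)ᵢ ∈ ℝ³`. -/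
def tsGrad (ε : ℝ) (m : ℕ) (G : UnitAddTorus (Fin 3) → ℝ) (Q : UnitAddTorus (Fin 4) → ℝ)
    (y : UnitAddTorus (Fin 4)) : EuclideanSpace ℝ (Fin 3) :=
  WithLp.toLp 2 fun i : Fin 3 => tsDeriv ε m G i Q y

/-- The two-scale STEADY residual with viscosity `ε²`, drift `c` along `x₂` and force `f(x)`:
`(P·D^ε)P − ε² ∑ᵢ(D^ε_i)²P + D^εQ − c D^ε_2 P − f ∘ slow` — the profile whose evaluation on the fast
phase is `w·∇w − ν_nΔw + ∇q − c∂₂w − f` for `w = P ∘ e_n`, `q = Q ∘ e_n`, `ε = ε_n`. -/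
def tsResidual (ε : ℝ) (m : ℕ) (G : UnitAddTorus (Fin 3) → ℝ)
    (f : UnitAddTorus (Fin 3) → EuclideanSpace ℝ (Fin 3)) (P : UnitAddTorus (Fin 4) → EuclideanSpace ℝ (Fin 3))
    (Q : UnitAddTorus (Fin 4) → ℝ) (c : ℝ) (y : UnitAddTorus (Fin 4)) : EuclideanSpace ℝ (Fin 3) :=
  tsConvect ε m G P P y - ε ^ 2 • tsLaplacian ε m G P y + tsGrad ε m G Q y - c • tsDeriv ε m G 2 P y - f (slow y)

/-- The fast-phase DISSIPATION DENSITY `|k(x)|² ‖∂_θ P(x,θ)‖²` of a profile: its `T⁴`-mean is the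
`ν → 0` limit of `ν‖∇w‖₂²` for the evaluated Taylor-scale family (`stub_taylorDissipationLaw`). -/
def dissDensity (m : ℕ) (G : UnitAddTorus (Fin 3) → ℝ) (P : UnitAddTorus (Fin 4) → EuclideanSpace ℝ (Fin 3))
    (y : UnitAddTorus (Fin 4)) : ℝ :=
  ∑ i : Fin 3, phaseGrad m G i (slow y) ^ 2 *
    ‖Literature.Analysis.FunctionSpaces.Torus.partialDeriv (Fin.last 3) P y‖ ^ 2

/-! ## Elementary facts about `ε_n`, `ν_n` (used by the composition; no `sorry`) -/

theorem epsN_pos (n : ℕ) : 0 < epsN n := by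
  unfold epsN
  positivity

theorem nuN_pos (n : ℕ) : 0 < nuN n := by
  unfold nuN
  exact pow_pos (epsN_pos n) 2

theorem sqrt_nuN (n : ℕ) : Real.sqrt (nuN n) = epsN n := by
  unfold nuN
  exact Real.sqrt_sq (epsN_pos n).le

theorem tendsto_epsN : Tendsto epsN atTop (𝓝 0) := by
  have h := tendsto_one_div_add_atTop_nhds_zero_nat (𝕜 := ℝ)
  exact h

theorem tendsto_nuN : Tendsto nuN atTop (𝓝 0) := by
  have h := (tendsto_epsN).pow 2
  rw [zero_pow two_ne_zero] at h
  exact h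

/-! ## The three registered stubs (the ONLY `sorry`s of this file) -/

/-- **stub 1 — ALL-ORDERS MONOPHASE PROFILE CONSTRUCTION (the heart of the crux; open, size XL).**
There are an axial wavenumber `m ≥ 1`, an `x₂`-independent smooth phase function `G` (phase
`S = m x₂ + G`), ONE smooth divergence-free mean-zero force `f`, an energy level `E` and a dissipation
level `ε₀ > 0` such that for every order `K` there is `C_K` with, for EVERY level `n`, smooth profiles
`P : T⁴ → ℝ³`, `Q : T⁴ → ℝ` and a drift `|c| ≤ C_K` that are: pointwise light (`‖P‖² ≤ E`), `C¹`-bounded in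
the slow variables uniformly in `n` (`‖∂ᵢP‖, ‖∂_θP‖, ‖∂ᵢ∂_θP‖ ≤ C_K`), LOUD on the fast phase
(`|∫_{T⁴} |k|²‖∂_θP‖² − ε₀| ≤ C_K ε_n`), horizontally mean-free after evaluation (`∫ (P∘e_n)₀ = ∫ (P∘e_n)₁ = 0`,
e.g. by the vertical-axis π-rotation symmetry of a vortex array, or because `P` is a two-scale curl),
EXACTLY two-scale divergence-free (`∑ D^ε_i Pᵢ = 0`; two-scale curls of profile potentials are, since the
`D^ε_i` commute — `k` is a gradient) and quasi-steady to order `K` AT THE PROFILE LEVEL: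
`‖(P·D^ε)P − ε²∑(D^ε_i)²P + D^εQ − cD^ε_2P − f∘slow‖² ≤ C_K ν_n^K` pointwise on `T⁴` (`ε = ε_n`, `ν_n = ε_n²`).
Intended proof (route text): `P = U + V₀ + εP₁ + … + ε^J P_J` with `U` a compact-vorticity steady planar
Euler array (`ω = F(ψ)`, `F′ = 0` off the wave band), `V₀(x,θ) = A(ψ)`·(neutral oblique Kelvin/elliptic-
instability Floquet mode at phase `θ`, viscous damping `|k|²∂_θ²` balancing the Lifschitz–Hameiri growth,
tuned by the obliqueness `G′`), `f := P_Leray(U·∇U + ⟨V₀·D V₀⟩_θ)`, higher profiles from the triangular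
monophase hierarchy (free `A_k, G_k, F_k, c_k` against the streamline-circulation conditions); small `n`
(where `ε_n` is not small) are absorbed by `C_K` with the trivial profile `P = 0`. This is the transfer
`C⁺` of the crux to PDEs on the fixed domain `T³ × T¹` in which `ε` enters only as a COEFFICIENT
(formal power series in `ε`, order-by-order linear solvability) — the standard BKW attack surface
(Cheverry–Guès–Métivier 2003; Cheverry arXiv:math/0402408; Lifschitz–Hameiri 1991; Bayly 1986).
Why it might fail = the crux's: neutral tuning needs a real simple top multiplier with transversal
crossing on a whole band; the circulation conditions at the band edges `A → 0`. -/
theorem stub_profiles :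
    ∃ (m : ℕ) (G : UnitAddTorus (Fin 3) → ℝ) (f : UnitAddTorus (Fin 3) → EuclideanSpace ℝ (Fin 3)) (E ε₀ : ℝ), 0 < m ∧ Literature.Analysis.FunctionSpaces.Torus.IsSmooth G ∧ (∀ x, Literature.Analysis.FunctionSpaces.Torus.partialDeriv (2 : Fin 3) G x = 0) ∧ Literature.Analysis.FunctionSpaces.Torus.IsSmooth f ∧ Literature.Analysis.FunctionSpaces.Torus.IsDivFree f ∧ Literature.Analysis.FunctionSpaces.Torus.HasZeroMean f ∧ 0 < ε₀ ∧ ∀ K : ℕ, ∃ C : ℝ, ∀ n : ℕ, ∃ (P : UnitAddTorus (Fin 4) → EuclideanSpace ℝ (Fin 3)) (Q : UnitAddTorus (Fin 4) → ℝ) (c : ℝ), Literature.Analysis.FunctionSpaces.Torus.IsSmooth P ∧ Literature.Analysis.FunctionSpaces.Torus.IsSmooth Q ∧ |c| ≤ C ∧ (∀ y, ‖P y‖ ^ 2 ≤ E) ∧ (∀ (i : Fin 3) y, ‖Literature.Analysis.FunctionSpaces.Torus.partialDeriv i.castSucc P y‖ ≤ C) ∧ (∀ y, ‖Literature.Analysis.FunctionSpaces.Torus.partialDeriv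 (Fin.last 3) P y‖ ≤ C) ∧ (∀ (i : Fin 3) y, ‖Literature.Analysis.FunctionSpaces.Torus.partialDeriv i.castSucc (Literature.Analysis.FunctionSpaces.Torus.partialDeriv (Fin.last 3) P) y‖ ≤ C) ∧ |(∫ y, dissDensity m G P y) - ε₀| ≤ C * epsN n ∧ (∫ x, P (phaseMap m G n x)) 0 = 0 ∧ (∫ x, P (phaseMap m G n x)) 1 = 0 ∧ (∀ y, tsDiv (epsN n) m G P y = 0) ∧ (∀ y, ‖tsResidual (epsN n) m G f P Q c y‖ ^ 2 ≤ C * nuN n ^ K) := by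
  sorry

/-- **stub 2 — TAYLOR DISSIPATION LAW (true, size M; two-scale chain rule + fast-phase averaging with rate).**
For `m ≥ 1`, `G` smooth with `∂₂G = 0` and a slow-`C¹` bound `M` there is `C₁ = C₁(m, G, M)` such that for
every level `n` and every smooth profile `P` with `‖∂ᵢP‖, ‖∂_θP‖, ‖∂ᵢ∂_θP‖ ≤ M`:
`|ν_n ‖∇(P ∘ e_n)‖₂² − ∫_{T⁴} |k|²‖∂_θP‖²| ≤ C₁ ε_n` — the viscous dissipation of a Taylor-scale monophase
family is the fast-phase average of `|∇S|²‖∂_θP‖²`, with rate `√ν`. Proof: `ν_n‖∇w‖² = ∫_{T³} ∑ᵢ‖ε∂ᵢP + kᵢ∂_θP‖² ∘ e_n`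
(chain rule `∂ᵢ(P∘e_n) = (D^ε_i P)∘e_n`, `Torus.fderiv_apply_eq_sum_partialDeriv`), cross terms `O(ε M²(1+|k|_∞))`;
then the AVERAGING LEMMA `|∫_{T³} h∘e_n − ∫_{T⁴} h| ≤ sup‖∂₂h‖/((n+1)m)` for `h = |k|²‖∂_θP‖²` (on each
`x₂`-interval of length `1/((n+1)m)` the phase `θ_n = (n+1)m x₂ + (n+1)G(x₀,x₁)` covers `T¹` exactly once
while `h` moves by `≤ sup‖∂₂h‖/((n+1)m)`; Fubini over `(x₀,x₁)`, translation invariance of Haar measure on `T¹`;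
cf. `Torus.axisAvg`, `Torus.measurePreserving_add_single`, `Torus.integral_comp_mulVecT_add`).
Why it is a stub and not glue: it is the one place where `ν‖∇w‖² → ε₀ > 0` (LOUD) is converted from a
profile integral, with the `O(√ν)` rate the crux demands. -/
theorem stub_taylorDissipationLaw :
    ∀ (m : ℕ) (G : UnitAddTorus (Fin 3) → ℝ) (M : ℝ), 0 < m → Literature.Analysis.FunctionSpaces.Torus.IsSmooth G → (∀ x, Literature.Analysis.FunctionSpaces.Torus.partialDeriv (2 : Fin 3) G x = 0) → ∃ C₁ : ℝ, ∀ (n : ℕ) (P : UnitAddTorus (Fin 4) → EuclideanSpace ℝ (Fin 3)), Literature.Analysis.FunctionSpaces.Torus.IsSmooth P → (∀ (i : Fin 3) y, ‖Literature.Analysis.FunctionSpaces.Torus.partialDeriv i.castSucc P y‖ ≤ M) → (∀ y, ‖Literature.Analysis.FunctionSpaces.Torus.partialDeriv (Fin.last 3) P y‖ ≤ M) → (∀ (i : Fin 3) y, ‖Literature.Analysis.FunctionSpaces.Torus.partialDeriv i.castSucc (Literature.Analysis.FunctionSpaces.Torus.partialDeriv (Fin.last 3) P) y‖ ≤ M)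 → |nuN n * Literature.Analysis.FunctionSpaces.Torus.gradNormSq (fun x => P (phaseMap m G n x)) - ∫ y, dissDensity m G P y| ≤ C₁ * epsN n := by
  sorry

/-- **stub 3 — TWO-SCALE EVALUATION / RESIDUAL TRANSFER with Galilean absorption of the vertical mean
(true, size M).** For smooth `G` there is `C₂ = C₂(E, C)` such that for every level `n`, all smooth
profiles `P, Q` and drift `|c| ≤ C` with `‖P‖² ≤ E`, zero horizontal means of `P ∘ e_n`, exact two-scale
incompressibility and profile residual `≤ C ν_n^K` pointwise, the NORMALISED evaluated field
`w := P∘e_n − a e₂`, `a := ∫ (P∘e_n)₂`, `q := Q∘e_n`, `c' := c − a` is smooth, divergence free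
(`div w = (∑ D^ε_i Pᵢ)∘e_n = 0`), has zero mean, `|c'| ≤ C + √E`, `∫‖w‖² = ∫‖P∘e_n‖² − a² ≤ E`,
`‖∇w‖₂² = ‖∇(P∘e_n)‖₂²`, and its steady residual is the evaluated profile residual POINTWISE:
`w·∇w − ν_nΔw + ∇q − c'∂₂w − f = [(P·D^ε)P − ε²∑(D^ε_i)²P + D^εQ − cD^ε_2P − f∘slow] ∘ e_n`
(the vertical Galilean shift is exact: `(W − ae₂)·∇(W − ae₂) − (c − a)∂₂(W − ae₂) = W·∇W − c∂₂W`; chain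
rule for first and second derivatives through `e_n`, which is smooth since `G` is;
`Torus.fderiv_apply_eq_sum_partialDeriv`, `Torus.laplacian_eq_sum_partialDeriv_partialDeriv`,
`Torus.gradient_apply`, `Fin.init_snoc`), so `∫‖residual‖² ≤ sup ≤ C ν_n^K`.
Why it is a stub and not glue: the second-order two-scale chain rule on `T³ → T⁴` and the exactness of
the constraints (div, mean) are where a BKW ansatz usually leaks; here they are honest lemmas. -/
theorem stub_residualTransfer :
    ∀ (m : ℕ) (G : UnitAddTorus (Fin 3) → ℝ) (f : UnitAddTorus (Fin 3) → EuclideanSpace ℝ (Fin 3)) (E C : ℝ) (K : ℕ), Literature.Analysis.FunctionSpaces.Torus.IsSmooth G → ∃ C₂ : ℝ, ∀ (n : ℕ) (P : UnitAddTorus (Fin 4) → EuclideanSpace ℝ (Fin 3)) (Q : UnitAddTorus (Fin 4) → ℝ) (c : ℝ), Literature.Analysis.FunctionSpaces.Torus.IsSmooth P → Literature.Analysis.FunctionSpaces.Torus.IsSmooth Q → |c| ≤ C → (∀ y, ‖P y‖ ^ 2 ≤ E) → (∫ x, P (phaseMap m G n x)) 0 = 0 → (∫ x, P (phaseMap m G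 n x)) 1 = 0 → (∀ y, tsDiv (epsN n) m G P y = 0) → (∀ y, ‖tsResidual (epsN n) m G f P Q c y‖ ^ 2 ≤ C * nuN n ^ K) → ∃ (w : UnitAddTorus (Fin 3) → EuclideanSpace ℝ (Fin 3)) (q : UnitAddTorus (Fin 3) → ℝ) (c' : ℝ), Literature.Analysis.FunctionSpaces.Torus.IsSmooth w ∧ Literature.Analysis.FunctionSpaces.Torus.IsSmooth q ∧ Literature.Analysis.FunctionSpaces.Torus.IsDivFree w ∧ Literature.Analysis.FunctionSpaces.Torus.HasZeroMean w ∧ |c'| ≤ C₂ ∧ MeasureTheory.integral MeasureTheory.volume (fun x => ‖w x‖ ^ 2) ≤ E ∧ Literature.Analysis.FunctionSpaces.Torus.gradNormSq w = Literature.Analysis.FunctionSpaces.Torus.gradNormSq (fun x => P (phaseMap m G n x)) ∧ MeasureTheory.integral MeasureTheory.volume (fun x => ‖Literature.Analysis.FunctionSpaces.Torus.convect w w x - (nuN n) • Literature.Analysis.FunctionSpaces.Torus.laplacian w x + Literature.Analysis.FunctionSpaces.Torus.gradient q x - c' • Literature.Analysis.FunctionSpaces.Torus.partialDeriv (2 :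 Fin 3) w x - f x‖ ^ 2) ≤ C₂ * (nuN n) ^ K := by
  sorry

/-! ## Name-keyed aliases of the three stub statements — the hypotheses of `TaylorWaveQuasiSteady_of`

The native skeleton audit (`#h21_check_skeleton`, run by `ledger skeleton check`) admits a hypothesis of the
composing theorem only if its head constant is a registered obligation or is NAMED like a declared stub;
`__Registered.stub_X` is the statement of `stub_X` verbatim under the stub's short name (device of
`Cruxes/KolmogorovBlowup/Lines/birth.lean`, `Cruxes/MirrorFloorTG/Lines/birth.lean`; the `__` namespace is an
implementation detail, so the audit's stub report resolves each `stub_…` to the sorried theorem above). Each alias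
is an `abbrev`, textually its stub's signature — generated from the same source string (`gen_birth.py`). -/
namespace __Registered

/-- Alias of the statement of `stub_profiles` (all-orders monophase profile construction), keyed by the stub name. -/
abbrev stub_profiles : Prop :=
  ∃ (m : ℕ) (G : UnitAddTorus (Fin 3) → ℝ) (f : UnitAddTorus (Fin 3) → EuclideanSpace ℝ (Fin 3)) (E ε₀ : ℝ), 0 < m ∧ Literature.Analysis.FunctionSpaces.Torus.IsSmooth G ∧ (∀ x, Literature.Analysis.FunctionSpaces.Torus.partialDeriv (2 : Fin 3) G x = 0) ∧ Literature.Analysis.FunctionSpaces.Torus.IsSmooth f ∧ Literature.Analysis.FunctionSpaces.Torus.IsDivFree f ∧ Literature.Analysis.FunctionSpaces.Torus.HasZeroMean f ∧ 0 < ε₀ ∧ ∀ K : ℕ, ∃ C : ℝ, ∀ n : ℕ, ∃ (P : UnitAddTorus (Fin 4) → EuclideanSpace ℝ (Fin 3)) (Q : UnitAddTorus (Fin 4) → ℝ) (c : ℝ), Literature.Analysis.FunctionSpaces.Torus.IsSmooth P ∧ Literature.Analysis.FunctionSpaces.Torus.IsSmooth Q ∧ |c| ≤ C ∧ (∀ y,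 ‖P y‖ ^ 2 ≤ E) ∧ (∀ (i : Fin 3) y, ‖Literature.Analysis.FunctionSpaces.Torus.partialDeriv i.castSucc P y‖ ≤ C) ∧ (∀ y, ‖Literature.Analysis.FunctionSpaces.Torus.partialDeriv (Fin.last 3) P y‖ ≤ C) ∧ (∀ (i : Fin 3) y, ‖Literature.Analysis.FunctionSpaces.Torus.partialDeriv i.castSucc (Literature.Analysis.FunctionSpaces.Torus.partialDeriv (Fin.last 3) P) y‖ ≤ C) ∧ |(∫ y, dissDensity m G P y) - ε₀| ≤ C * epsN n ∧ (∫ x, P (phaseMap m G n x)) 0 = 0 ∧ (∫ x, P (phaseMap m G n x)) 1 = 0 ∧ (∀ y, tsDiv (epsN n) m G P y = 0) ∧ (∀ y, ‖tsResidual (epsN n) m G f P Q c y‖ ^ 2 ≤ C * nuN n ^ K)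

/-- Alias of the statement of `stub_taylorDissipationLaw` (Taylor dissipation law), keyed by the stub name. -/
abbrev stub_taylorDissipationLaw : Prop :=
  ∀ (m : ℕ) (G : UnitAddTorus (Fin 3) → ℝ) (M : ℝ), 0 < m → Literature.Analysis.FunctionSpaces.Torus.IsSmooth G → (∀ x, Literature.Analysis.FunctionSpaces.Torus.partialDeriv (2 : Fin 3) G x = 0) → ∃ C₁ : ℝ, ∀ (n : ℕ) (P : UnitAddTorus (Fin 4) → EuclideanSpace ℝ (Fin 3)), Literature.Analysis.FunctionSpaces.Torus.IsSmooth P → (∀ (i : Fin 3) y, ‖Literature.Analysis.FunctionSpaces.Torus.partialDeriv i.castSucc P y‖ ≤ M) → (∀ y, ‖Literature.Analysis.FunctionSpaces.Torus.partialDeriv (Fin.last 3) P y‖ ≤ M) → (∀ (i : Fin 3) y, ‖Literature.Analysis.FunctionSpaces.Torus.partialDeriv i.castSucc (Literature.Analysis.FunctionSpaces.Torus.partialDeriv (Fin.last 3) P) y‖ ≤ M) → |nuN n * Literature.Analysis.FunctionSpaces.Torus.gradNormSq (fun x => P (phaseMap m G n x)) - ∫ y, dissDensity m G P y| ≤ C₁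 * epsN n

/-- Alias of the statement of `stub_residualTransfer` (two-scale evaluation / residual transfer), keyed by the stub name. -/
abbrev stub_residualTransfer : Prop :=
  ∀ (m : ℕ) (G : UnitAddTorus (Fin 3) → ℝ) (f : UnitAddTorus (Fin 3) → EuclideanSpace ℝ (Fin 3)) (E C : ℝ) (K : ℕ), Literature.Analysis.FunctionSpaces.Torus.IsSmooth G → ∃ C₂ : ℝ, ∀ (n : ℕ) (P : UnitAddTorus (Fin 4) → EuclideanSpace ℝ (Fin 3)) (Q : UnitAddTorus (Fin 4) → ℝ) (c : ℝ), Literature.Analysis.FunctionSpaces.Torus.IsSmooth P → Literature.Analysis.FunctionSpaces.Torus.IsSmooth Q → |c| ≤ C → (∀ y, ‖P y‖ ^ 2 ≤ E) → (∫ x, P (phaseMap m G n x)) 0 = 0 → (∫ x, P (phaseMap m G n x)) 1 = 0 → (∀ y, tsDiv (epsN n) m G P y = 0) → (∀ y, ‖tsResidual (epsN n) m G f P Q c y‖ ^ 2 ≤ C * nuN n ^ K) → ∃ (w : UnitAddTorus (Fin 3) → EuclideanSpace ℝ (Fin 3)) (q : UnitAddTorus (Fin 3) → ℝ) (c' : ℝ),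 Literature.Analysis.FunctionSpaces.Torus.IsSmooth w ∧ Literature.Analysis.FunctionSpaces.Torus.IsSmooth q ∧ Literature.Analysis.FunctionSpaces.Torus.IsDivFree w ∧ Literature.Analysis.FunctionSpaces.Torus.HasZeroMean w ∧ |c'| ≤ C₂ ∧ MeasureTheory.integral MeasureTheory.volume (fun x => ‖w x‖ ^ 2) ≤ E ∧ Literature.Analysis.FunctionSpaces.Torus.gradNormSq w = Literature.Analysis.FunctionSpaces.Torus.gradNormSq (fun x => P (phaseMap m G n x)) ∧ MeasureTheory.integral MeasureTheory.volume (fun x => ‖Literature.Analysis.FunctionSpaces.Torus.convect w w x - (nuN n) • Literature.Analysis.FunctionSpaces.Torus.laplacian w x + Literature.Analysis.FunctionSpaces.Torus.gradient q x - c' • Literature.Analysis.FunctionSpaces.Torus.partialDeriv (2 : Fin 3) w x - f x‖ ^ 2) ≤ C₂ * (nuN n) ^ K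

end __Registered

/-- **Composition** (kernel-checked, no `sorry` of its own): the three stub statements (as the name-keyed
aliases `__Registered.stub_*`) imply the crux
`Summit.AnomalousDissipation.AnomalousDissipation.Theses.NeutralTaylorWaves.TaylorWaveQuasiSteady` BY NAME.
`ν_n := nuN n = 1/(n+1)²`; force, energy and dissipation levels from stub 1; for each `K` the constants
`C_K` (stub 1), `C₁` (stub 2 with `M := C_K`), `C₂` (stub 3) are combined as `max C₂ (C₁ + C_K)`; the field,
pressure and drift at level `n` are those returned by stub 3 on the level-`n` profiles of stub 1; LOUD is the
triangle inequality through `∫ dissDensity` with `√ν_n = ε_n`. [folklore] -/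
theorem TaylorWaveQuasiSteady_of :
    __Registered.stub_profiles → __Registered.stub_taylorDissipationLaw → __Registered.stub_residualTransfer →
      Summit.AnomalousDissipation.AnomalousDissipation.Theses.NeutralTaylorWaves.TaylorWaveQuasiSteady := by
  intro H1 H2 H3
  dsimp only [__Registered.stub_profiles, __Registered.stub_taylorDissipationLaw,
    __Registered.stub_residualTransfer] at H1 H2 H3
  obtain ⟨m, G, f, E, ε₀, hm, hG, hG2, hf, hfdiv, hfmean, hε₀, hK⟩ := H1
  refine ⟨f, hf, hfdiv, hfmean, nuN, E, ε₀, nuN_pos, tendsto_nuN, hε₀, fun K => ?_⟩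
  obtain ⟨C, hC⟩ := hK K
  obtain ⟨C₁, hC₁⟩ := H2 m G C hm hG hG2
  obtain ⟨C₂, hC₂⟩ := H3 m G f E C K hG
  refine ⟨max C₂ (C₁ + C), fun n => ?_⟩
  obtain ⟨P, Q, c, hP, hQ, hc, hPE, hd1, hdθ, hd2, hdiss, hm0, hm1, hdiv, hres⟩ := hC n
  obtain ⟨w, q, c', hw, hq, hwdiv, hwmean, hc', hwE, hgrad, hwres⟩ :=
    hC₂ n P Q c hP hQ hc hPE hm0 hm1 hdiv hres
  have hB := hC₁ n P hP hd1 hdθ hd2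
  refine ⟨w, q, c', hw, hq, hwdiv, hwmean, hc'.trans (le_max_left _ _), hwE, ?_, ?_⟩
  · -- LOUD: |ν_n ‖∇w‖² − ε₀| ≤ |ν_n ‖∇(P∘e_n)‖² − ∫ dissDensity| + |∫ dissDensity − ε₀| ≤ (C₁ + C) ε_n
    rw [hgrad, sqrt_nuN]
    have htri : |nuN n * Literature.Analysis.FunctionSpaces.Torus.gradNormSq (fun x => P (phaseMap m G n x)) - ε₀| ≤
        C₁ * epsN n + C * epsN n :=
      (abs_sub_le _ _ _).trans (add_le_add hB hdiss)
    calc |nuN n * Literature.Analysis.FunctionSpaces.Torus.gradNormSq (fun x => P (phaseMap m G n x)) - ε₀|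
        ≤ (C₁ + C) * epsN n := by rw [add_mul]; exact htri
      _ ≤ max C₂ (C₁ + C) * epsN n :=
          mul_le_mul_of_nonneg_right (le_max_right _ _) (epsN_pos n).le
  · -- QUASI-STEADY: the residual bound of stub 3 with the larger constant
    exact hwres.trans (mul_le_mul_of_nonneg_right (le_max_left _ _) (pow_nonneg (nuN_pos n).le K))

/-- **The skeleton in its final shape** (D-0027 §3.3): the crux BY NAME from the three registered stubs, through
the sorry-free composition `TaylorWaveQuasiSteady_of`; it becomes the crux proof when the last `stub_*` is
discharged (until then it depends on `sorryAx` through the stubs ONLY — no `sorry` of its own). This file lives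
under `Cruxes/…/Lines/` (elaborated, never built or imported), so no BC probe can reach this constant by `exact?`;
the BC3 probes of this line import only the route file (NOTES.md of the registrar seat). -/
theorem TaylorWaveQuasiSteady_skeleton :
    Summit.AnomalousDissipation.AnomalousDissipation.Theses.NeutralTaylorWaves.TaylorWaveQuasiSteady :=
  TaylorWaveQuasiSteady_of stub_profiles stub_taylorDissipationLaw stub_residualTransfer

end Summit.AnomalousDissipation.AnomalousDissipation.Cruxes.TaylorWaveQuasiSteady.Birth

end
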